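import Literature.Probability.RandomGraphs.PlantedClique
import Literature.Combinatorics.SetFamily.ParkPham

/-!
# Crux `MonotoneBlind` (stmt-PneNP-18027, route KarlinRubin), line `Sketch`: up-sets, biased measures and cheap covers

Vertex-lattice bookkeeping for the completeness of the dual cover certificate of line `Sketch`
(`Cruxes/MonotoneBlind/Lines/Sketch.lean`; the assembly is in
`KarlinRubinMonotoneBlindCoverCompleteness.lean`). For an UP-SET `U` of vertex subsets of `Kₙ`:

* `density_powersetCard_mono_of_upset` — the uniform `j`-set density of `U` increases with `j`
  (double counting `card_filter_powersetCard_mul_choose_le_of_upset`);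
* `sum_biasedWeight_upset_le` — `μ_p(U) ≤ (k-set density of U) + Pr_p[|W| > k]`, with the mean
  size `sum_biasedWeight_mul_card` (`E_p|W| = p|X|`) and the Markov tail
  `mul_sum_biasedWeight_card_gt_le`;
* `exists_cover_cost_lt_one_of_biased_le_half` — contrapositive of the **Park–Pham theorem**
  (`Literature.Combinatorics.SetFamily.parkPham_spreadConst`, Kahn–Kalai conjecture, `p`-biased
  form): `μ_p(U) ≤ 1/2` forces a cover of `U` of `q`-cost `< 1`, `q = p/(B log 2n)`;
* `sum_pow_card_le_of_scale`, `coverCost_ennreal_eq_ofReal`, `natCast_div_le_quarter` — rescaling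
  and `ℝ≥0∞` bookkeeping;
* `exists_cheap_cover_of_kSet_le` — **the deterministic core at one `n`**: if the uniform-`k'`-set
  measure of `U` is `≤ 1/4` and `5 B log(2n) · D ≤ η k'`, then `U` has a cover of `(D/n)`-cost
  `≤ η`.

All `--supports stmt-PneNP-18027`; no definitions.

References: J. Park, H. T. Pham, J. Amer. Math. Soc. 37 (2024), Thm. 1.1 [ParkPham2024];
T. Bell, Electron. J. Combin. 30(2) (2023), Thm. 3 [Bell2023]; M. Talagrand, STOC 2010 [Talagrand2010].
-/

set_option linter.dupNamespace false -- `Summit.PneNP.PneNP.…` is the layout-mandated namespace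

namespace Summit.PneNP.PneNP.Theorems.MonotoneBlind.VertexCover

open Literature.Computability.Complexity Literature.Probability.RandomGraphs.PlantedClique Filter Finset
open Literature.Combinatorics.SetFamily
open scoped ENNReal Topology Classical

/-! ### Uniform `j`-set densities of an up-set are monotone in `j` -/

/-- **Double count, up-set form.** For an up-set `U` of subsets of `Fin n` and `j ≤ k ≤ n`:
`#{S ∈ U : |S| = j} · C(n,k) ≤ #{T ∈ U : |T| = k} · C(n,j)` (for `j ≤ k`; trivial if `k > n`) — every `j`-set in `U` has
`C(n-j, k-j)` `k`-supersets, all in `U`, each `k`-set has `C(k,j)` `j`-subsets, and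
`C(n,k) C(k,j) = C(n,j) C(n-j,k-j)`. [folklore] -/
theorem card_filter_powersetCard_mul_choose_le_of_upset {n : ℕ} (U : Set (Finset (Fin n)))
    (hU : ∀ S T : Finset (Fin n), S ⊆ T → S ∈ U → T ∈ U) {j k : ℕ} (hjk : j ≤ k) :
    #((powersetCard j (univ : Finset (Fin n))).filter (· ∈ U)) * n.choose k ≤
      #((powersetCard k (univ : Finset (Fin n))).filter (· ∈ U)) * n.choose j := by
  classical
  set Uj := (powersetCard j (univ : Finset (Fin n))).filter (· ∈ U) with hUj
  set Uk := (powersetCard k (univ : Finset (Fin n))).filter (· ∈ U) with hUk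
  -- the pairs `(S, T)` with `S ∈ Uj`, `T` a `k`-superset of `S`
  set P := (Uj ×ˢ powersetCard k (univ : Finset (Fin n))).filter fun y => y.1 ⊆ y.2 with hP
  -- counted by `S`: each `S` has `C(n-j, k-j)` supersets
  have hcountS : #P = #Uj * (n - j).choose (k - j) := by
    rw [hP, card_filter, sum_product]
    have : ∀ S ∈ Uj, (∑ T ∈ powersetCard k (univ : Finset (Fin n)), if S ⊆ T then 1 else 0)
        = (n - j).choose (k - j) := by
      intro S hS
      have hSj : #S = j := (mem_powersetCard.1 (mem_filter.1 hS).1).2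
      rw [← card_filter, Finset.card_filter_powersetCard_subset S univ k (subset_univ S) (hSj ▸ hjk),
        card_univ, Fintype.card_fin, hSj]
    rw [sum_congr rfl this, sum_const, smul_eq_mul]
  -- counted by `T`: each `T ∈ Uk` has at most `C(k, j)` subsets of size `j`, and `T ∈ Uk` is forced
  have hcountT : #P ≤ #Uk * k.choose j := by
    have hsub : P ⊆ (Uj ×ˢ Uk).filter fun y => y.1 ⊆ y.2 := by
      intro y hy
      obtain ⟨hy1, hy2⟩ := mem_filter.1 hy
      obtain ⟨hS, hT⟩ := mem_product.1 hy1
      refine mem_filter.2 ⟨mem_product.2 ⟨hS, mem_filter.2 ⟨hT, ?_⟩⟩, hy2⟩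
      exact hU y.1 y.2 hy2 (mem_filter.1 hS).2
    refine (card_le_card hsub).trans ?_
    rw [card_filter, sum_product_right]
    have : ∀ T ∈ Uk, (∑ S ∈ Uj, if S ⊆ T then 1 else 0) ≤ k.choose j := by
      intro T hT
      have hTk : #T = k := (mem_powersetCard.1 (mem_filter.1 hT).1).2
      rw [← card_filter]
      calc #(Uj.filter fun S => S ⊆ T) ≤ #(powersetCard j T) := by
            refine card_le_card fun S hS => ?_
            obtain ⟨hS1, hS2⟩ := mem_filter.1 hS
            exact mem_powersetCard.2 ⟨hS2, (mem_powersetCard.1 (mem_filter.1 hS1).1).2⟩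
        _ = k.choose j := by rw [card_powersetCard, hTk]
    calc ∑ T ∈ Uk, ∑ S ∈ Uj, (if S ⊆ T then 1 else 0) ≤ ∑ T ∈ Uk, k.choose j := sum_le_sum this
      _ = #Uk * k.choose j := by rw [sum_const, smul_eq_mul]
  -- combine with `C(n,k) C(k,j) = C(n,j) C(n-j,k-j)`
  have hchoose : n.choose k * k.choose j = n.choose j * (n - j).choose (k - j) :=
    Nat.choose_mul (n := n) hjk
  have hkj : 0 < k.choose j := Nat.choose_pos hjk
  have key : #Uj * (n - j).choose (k - j) ≤ #Uk * k.choose j := hcountS ▸ hcountT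
  have : #Uj * n.choose k * k.choose j ≤ #Uk * n.choose j * k.choose j := by
    calc #Uj * n.choose k * k.choose j = #Uj * (n.choose j * (n - j).choose (k - j)) := by
          rw [mul_assoc, hchoose]
      _ = #Uj * (n - j).choose (k - j) * n.choose j := by ring
      _ ≤ #Uk * k.choose j * n.choose j := Nat.mul_le_mul_right _ key
      _ = #Uk * n.choose j * k.choose j := by ring
  exact Nat.le_of_mul_le_mul_right this hkj

/-- **Up-set densities increase with the size**: for an up-set `U` and `j ≤ k ≤ n`, the fraction
of `j`-subsets of `Fin n` in `U` is at most the fraction of `k`-subsets in `U`. [folklore] -/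
theorem density_powersetCard_mono_of_upset {n : ℕ} (U : Set (Finset (Fin n)))
    (hU : ∀ S T : Finset (Fin n), S ⊆ T → S ∈ U → T ∈ U) {j k : ℕ} (hjk : j ≤ k) (hkn : k ≤ n) :
    (#((powersetCard j (univ : Finset (Fin n))).filter (· ∈ U)) : ℝ) / n.choose j ≤
      (#((powersetCard k (univ : Finset (Fin n))).filter (· ∈ U)) : ℝ) / n.choose k := by
  have hj : (0 : ℝ) < n.choose j := by exact_mod_cast Nat.choose_pos (hjk.trans hkn)
  have hk : (0 : ℝ) < n.choose k := by exact_mod_cast Nat.choose_pos hkn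
  rw [div_le_div_iff₀ hj hk]
  exact_mod_cast card_filter_powersetCard_mul_choose_le_of_upset U hU hjk

/-! ### The `p`-biased measure of an up-set versus its `k`-set density -/

/-- **Mean size under the biased measure**: `E_p |W| = p · |X|`. [folklore] -/
theorem sum_biasedWeight_mul_card {α : Type*} [Fintype α] [DecidableEq α] (p : ℝ) :
    ∑ W : Finset α, biasedWeight p W * (#W : ℝ) = p * Fintype.card α := by
  have hcard : ∀ W : Finset α, (#W : ℝ) = ∑ v : α, if v ∈ W then (1 : ℝ) else 0 := by
    intro W
    rw [Finset.sum_boole, Finset.filter_mem_eq_inter, Finset.univ_inter]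
  simp_rw [hcard, mul_sum]
  rw [sum_comm]
  have hv : ∀ v : α, ∑ W : Finset α, biasedWeight p W * (if v ∈ W then (1 : ℝ) else 0) = p := by
    intro v
    have h := sum_biasedWeight_filter_subset (α := α) p {v}
    rw [card_singleton, pow_one, sum_filter] at h
    refine Eq.trans (sum_congr rfl fun W _ => ?_) h
    by_cases hvW : v ∈ W
    · simp [hvW]
    · simp [hvW]
  simp_rw [hv]
  rw [sum_const, card_univ, nsmul_eq_mul, mul_comm]

/-- **Markov tail for the size**: `k · Pr_p[|W| > k] ≤ p · |X|`. [folklore] -/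
theorem mul_sum_biasedWeight_card_gt_le {α : Type*} [Fintype α] [DecidableEq α] {p : ℝ}
    (hp0 : 0 ≤ p) (hp1 : p ≤ 1) (k : ℕ) :
    (k : ℝ) * ∑ W ∈ univ.filter (fun W : Finset α => k < #W), biasedWeight p W ≤
      p * Fintype.card α := by
  have h := mul_sum_biasedWeight_filter_lt_le (α := α) hp0 hp1 (k : ℝ) (fun W => (#W : ℝ))
    (fun W => Nat.cast_nonneg _)
  rw [sum_biasedWeight_mul_card] at h
  convert h using 3
  ext W
  simp

/-- **Biased measure versus `k`-set density for an up-set.** For an up-set `U` of subsets of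
`Fin n`, `k ≤ n` and `p ∈ [0,1]`: `μ_p(U) ≤ #{T ∈ U : |T| = k} / C(n,k) + Pr_p[|W| > k]`
(decompose `μ_p` by `|W|`; for `|W| = j ≤ k` the `j`-density is at most the `k`-density, for
`j > k` bound by the tail). [folklore] -/
theorem sum_biasedWeight_upset_le {n : ℕ} (U : Set (Finset (Fin n)))
    (hU : ∀ S T : Finset (Fin n), S ⊆ T → S ∈ U → T ∈ U) {k : ℕ} (hkn : k ≤ n) {p : ℝ}
    (hp0 : 0 ≤ p) (hp1 : p ≤ 1) :
    ∑ W ∈ univ.filter (fun W : Finset (Fin n) => W ∈ U), biasedWeight p W ≤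
      (#((powersetCard k (univ : Finset (Fin n))).filter (· ∈ U)) : ℝ) / n.choose k +
        ∑ W ∈ univ.filter (fun W : Finset (Fin n) => k < #W), biasedWeight p W := by
  classical
  set r : ℝ := (#((powersetCard k (univ : Finset (Fin n))).filter (· ∈ U)) : ℝ) / n.choose k with hr
  -- split `U` into small and large members
  have hsplit : ∑ W ∈ univ.filter (fun W : Finset (Fin n) => W ∈ U), biasedWeight p W
      = ∑ W ∈ univ.filter (fun W : Finset (Fin n) => W ∈ U ∧ #W ≤ k), biasedWeight p W
        + ∑ W ∈ univ.filter (fun W : Finset (Fin n) => W ∈ U ∧ k < #W), biasedWeight p W := by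
    rw [← sum_filter_add_sum_filter_not (univ.filter fun W : Finset (Fin n) => W ∈ U)
      (fun W => #W ≤ k)]
    congr 1
    · rw [filter_filter]
    · rw [filter_filter]
      congr 1
      ext W
      simp [not_le]
  rw [hsplit]
  refine add_le_add ?_ ?_
  · -- small members: fibre over `j = #W ≤ k`
    have hfib : ∑ W ∈ univ.filter (fun W : Finset (Fin n) => W ∈ U ∧ #W ≤ k), biasedWeight p W
        = ∑ j ∈ range (k + 1), ∑ W ∈ (powersetCard j (univ : Finset (Fin n))).filter (· ∈ U),
            biasedWeight p W := by
      rw [← sum_fiberwise_of_maps_to (s := univ.filter fun W : Finset (Fin n) => W ∈ U ∧ #W ≤ k)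
        (t := range (k + 1)) (g := fun W => #W) (fun W hW => by
          rw [mem_range]; exact Nat.lt_succ_of_le (mem_filter.1 hW).2.2)]
      refine sum_congr rfl fun j hj => ?_
      congr 1
      ext W
      simp only [mem_filter, mem_univ, true_and, mem_powersetCard, subset_univ]
      constructor
      · rintro ⟨⟨hWU, -⟩, hWj⟩; exact ⟨hWj, hWU⟩
      · rintro ⟨hWj, hWU⟩; exact ⟨⟨hWU, by rw [mem_range] at hj; omega⟩, hWj⟩
    rw [hfib]
    -- on the `j`-slice the weight is constant `p^j (1-p)^{n-j}`
    have hslice : ∀ j ∈ range (k + 1),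
        ∑ W ∈ (powersetCard j (univ : Finset (Fin n))).filter (· ∈ U), biasedWeight p W
          ≤ r * (∑ W ∈ powersetCard j (univ : Finset (Fin n)), biasedWeight p W) := by
      intro j hj
      rw [mem_range] at hj
      have hjk : j ≤ k := Nat.lt_succ_iff.1 hj
      have hconst : ∀ W ∈ powersetCard j (univ : Finset (Fin n)),
          biasedWeight p W = p ^ j * (1 - p) ^ (n - j) := by
        intro W hW
        rw [biasedWeight, (mem_powersetCard.1 hW).2, Fintype.card_fin]
      rw [sum_congr rfl fun W hW => hconst W (mem_filter.1 hW).1, sum_congr rfl hconst, sum_const,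
        sum_const, card_powersetCard, card_univ, Fintype.card_fin, nsmul_eq_mul, nsmul_eq_mul]
      have hdens := density_powersetCard_mono_of_upset U hU hjk hkn
      have hcj : (0 : ℝ) < n.choose j := by exact_mod_cast Nat.choose_pos (hjk.trans hkn)
      have hw : 0 ≤ p ^ j * (1 - p) ^ (n - j) := mul_nonneg (pow_nonneg hp0 _) (pow_nonneg (by linarith) _)
      calc (#((powersetCard j (univ : Finset (Fin n))).filter (· ∈ U)) : ℝ) * (p ^ j * (1 - p) ^ (n - j))
          = ((#((powersetCard j (univ : Finset (Fin n))).filter (· ∈ U)) : ℝ) / n.choose j) *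
              ((n.choose j : ℝ) * (p ^ j * (1 - p) ^ (n - j))) := by
            field_simp
        _ ≤ r * ((n.choose j : ℝ) * (p ^ j * (1 - p) ^ (n - j))) :=
            mul_le_mul_of_nonneg_right hdens (mul_nonneg hcj.le hw)
    calc ∑ j ∈ range (k + 1), ∑ W ∈ (powersetCard j (univ : Finset (Fin n))).filter (· ∈ U),
            biasedWeight p W
        ≤ ∑ j ∈ range (k + 1), r * ∑ W ∈ powersetCard j (univ : Finset (Fin n)), biasedWeight p W :=
          sum_le_sum hslice
      _ = r * ∑ j ∈ range (k + 1), ∑ W ∈ powersetCard j (univ : Finset (Fin n)), biasedWeight p W := by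
          rw [mul_sum]
      _ ≤ r * 1 := by
          refine mul_le_mul_of_nonneg_left ?_ (by rw [hr]; positivity)
          calc ∑ j ∈ range (k + 1), ∑ W ∈ powersetCard j (univ : Finset (Fin n)), biasedWeight p W
              = ∑ W ∈ univ.filter (fun W : Finset (Fin n) => #W ≤ k), biasedWeight p W := by
                rw [← sum_fiberwise_of_maps_to (s := univ.filter fun W : Finset (Fin n) => #W ≤ k)
                  (t := range (k + 1)) (g := fun W => #W) (fun W hW => by
                    rw [mem_range]; exact Nat.lt_succ_of_le (mem_filter.1 hW).2)]
                refine sum_congr rfl fun j hj => ?_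
                congr 1
                ext W
                simp only [mem_filter, mem_univ, true_and, mem_powersetCard, subset_univ]
                rw [mem_range] at hj
                constructor
                · intro hWj; exact ⟨by omega, hWj⟩
                · rintro ⟨-, hWj⟩; exact hWj
            _ ≤ ∑ W : Finset (Fin n), biasedWeight p W :=
                sum_le_sum_of_subset_of_nonneg (filter_subset _ _) fun W _ _ =>
                  biasedWeight_nonneg hp0 hp1 W
            _ = 1 := sum_biasedWeight p
      _ = r := mul_one r
  · exact sum_le_sum_of_subset_of_nonneg (fun W hW => by
      rw [mem_filter] at hW ⊢; exact ⟨hW.1, hW.2.2⟩) fun W _ _ => biasedWeight_nonneg hp0 hp1 W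


/-! ### Park–Pham: an up-set of biased measure `≤ 1/2` has a cheap cover -/

/-- **Cheap covers from small biased measure** (contrapositive of the Park–Pham theorem at
`ε = 1/2`, `ℓ = n`): if an up-set `U` of subsets of `Fin n` (`n ≥ 1`) has `μ_p(U) ≤ 1/2` for some
`p ∈ (0, 1/2]`, then some family `G` covers `U` (every member of `U` contains a member of `G`)
with `∑_{S ∈ G} q^{|S|} < 1`, `q = p / (B log(2n))`, `B = spreadConst`. [folklore] -/
theorem exists_cover_cost_lt_one_of_biased_le_half {n : ℕ} (hn : 1 ≤ n) (U : Set (Finset (Fin n)))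
    (hU : ∀ S T : Finset (Fin n), S ⊆ T → S ∈ U → T ∈ U) {p : ℝ} (hp0 : 0 < p) (hp1 : p ≤ 1 / 2)
    (hμ : ∑ W ∈ univ.filter (fun W : Finset (Fin n) => W ∈ U), biasedWeight p W ≤ 1 / 2) :
    ∃ G : Finset (Finset (Fin n)), (∀ A ∈ U, ∃ S ∈ G, S ⊆ A) ∧
      ∑ S ∈ G, (p / (spreadConst * Real.log ((n : ℕ) / (1 / 2 : ℝ)))) ^ #S < 1 := by
  classical
  set F : Finset (Finset (Fin n)) := univ.filter fun W => W ∈ U with hF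
  by_contra hcon
  push Not at hcon
  have hns : ∀ G : Finset (Finset (Fin n)), (∀ S ∈ F, ∃ T ∈ G, T ⊆ S) →
      1 ≤ ∑ T ∈ G, (p / (spreadConst * Real.log ((n : ℕ) / (1 / 2 : ℝ)))) ^ #T := by
    intro G hG
    refine hcon G fun A hA => ?_
    exact hG A (mem_filter.2 ⟨mem_univ _, hA⟩)
  have hbdd : ∀ S ∈ F, #S ≤ n := fun S _ => (card_le_univ S).trans (by rw [Fintype.card_fin])
  have hPP := parkPham_spreadConst F n p (1 / 2) hn hp0 hp1 (by norm_num) (by norm_num) hbdd hns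
  have hset : (univ.filter fun W : Finset (Fin n) => ∃ S ∈ F, S ⊆ W) = F := by
    ext W
    simp only [hF, mem_filter, mem_univ, true_and]
    constructor
    · rintro ⟨S, hS, hSW⟩; exact hU S W hSW hS
    · intro hW; exact ⟨W, hW, Subset.refl _⟩
  rw [hset] at hPP
  linarith

/-- **Rescaling a sub-unit cover**: if `∑_{S ∈ G} q^{|S|} < 1` (so `∅ ∉ G`) and `ρ ≤ η q` with
`η ∈ [0, 1]`, then `∑_{S ∈ G} ρ^{|S|} ≤ η`. [folklore] -/
theorem sum_pow_card_le_of_scale {n : ℕ} {G : Finset (Finset (Fin n))} {q ρ η : ℝ} (hq : 0 ≤ q)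
    (hρ0 : 0 ≤ ρ) (hη0 : 0 ≤ η) (hη1 : η ≤ 1) (hρ : ρ ≤ η * q) (hG : ∑ S ∈ G, q ^ #S < 1) :
    ∑ S ∈ G, ρ ^ #S ≤ η := by
  have hne : ∀ S ∈ G, 1 ≤ #S := by
    intro S hS
    by_contra h0
    have hS0 : #S = 0 := by omega
    have : (1 : ℝ) ≤ ∑ S ∈ G, q ^ #S := by
      calc (1 : ℝ) = q ^ #S := by rw [hS0, pow_zero]
        _ ≤ ∑ S ∈ G, q ^ #S := single_le_sum (fun T _ => pow_nonneg hq _) hS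
    linarith
  calc ∑ S ∈ G, ρ ^ #S ≤ ∑ S ∈ G, η * q ^ #S := by
        refine sum_le_sum fun S hS => ?_
        calc ρ ^ #S ≤ (η * q) ^ #S := pow_le_pow_left₀ hρ0 hρ _
          _ = η ^ #S * q ^ #S := mul_pow η q _
          _ ≤ η * q ^ #S := by
              refine mul_le_mul_of_nonneg_right ?_ (pow_nonneg hq _)
              calc η ^ #S ≤ η ^ 1 := pow_le_pow_of_le_one hη0 hη1 (hne S hS)
                _ = η := pow_one η
    _ = η * ∑ S ∈ G, q ^ #S := by rw [mul_sum]
    _ ≤ η * 1 := mul_le_mul_of_nonneg_left hG.le hη0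
    _ = η := mul_one η

/-- The `(d/n)`-cost of a family in `ℝ≥0∞` is the real cost. [folklore] -/
theorem coverCost_ennreal_eq_ofReal {n : ℕ} (hn : 0 < n) (d : ℕ) (G : Finset (Finset (Fin n))) :
    ∑ S ∈ G, (((d : ℕ) : ℝ≥0∞) / (n : ℝ≥0∞)) ^ S.card =
      ENNReal.ofReal (∑ S ∈ G, ((d : ℝ) / n) ^ #S) := by
  have hn0 : (n : ℝ≥0∞) ≠ 0 := by exact_mod_cast hn.ne'
  have hterm : ∀ S : Finset (Fin n), (((d : ℕ) : ℝ≥0∞) / (n : ℝ≥0∞)) ^ S.card =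
      ENNReal.ofReal (((d : ℝ) / n) ^ #S) := by
    intro S
    rw [ENNReal.ofReal_pow (by positivity), ENNReal.ofReal_div_of_pos (by exact_mod_cast hn),
      ENNReal.ofReal_natCast, ENNReal.ofReal_natCast]
  rw [ENNReal.ofReal_sum_of_nonneg (fun S _ => by positivity)]
  exact sum_congr rfl fun S _ => hterm S

/-! ### The deterministic core at one `n` -/

/-- `ℝ≥0∞` density bound to a real density bound. [folklore] -/
theorem natCast_div_le_quarter {a b : ℕ} (hb : 0 < b)
    (h : ((a : ℝ≥0∞) / (b : ℝ≥0∞)) ≤ 4⁻¹) : (a : ℝ) / b ≤ 1 / 4 := by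
  have hb0 : (b : ℝ≥0∞) ≠ 0 := by exact_mod_cast hb.ne'
  have hbt : (b : ℝ≥0∞) ≠ ⊤ := ENNReal.natCast_ne_top b
  rw [ENNReal.div_le_iff hb0 hbt] at h
  have h4 : (4⁻¹ : ℝ≥0∞) * (b : ℝ≥0∞) ≠ ⊤ := ENNReal.mul_ne_top (by simp) hbt
  have h' := (ENNReal.toReal_le_toReal (ENNReal.natCast_ne_top a) h4).2 h
  rw [ENNReal.toReal_mul, ENNReal.toReal_inv, ENNReal.toReal_natCast, ENNReal.toReal_natCast] at h'
  have hbr : (0 : ℝ) < b := by exact_mod_cast hb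
  rw [div_le_iff₀ hbr]
  simpa [one_div] using h'

/-- **Core lemma (one `n`, deterministic).** Let `U` be an up-set of vertex subsets of `Kₙ`
(`n ≥ 1`), `1 ≤ k' ≤ n`, `D : ℕ` a cover scale and `η ∈ (0, 1]` with `5 B log(2n) · D ≤ η k'`
(`B = spreadConst`). If the uniform-`k'`-set measure of `U` is `≤ 1/4`, then `U` has a cover `G`
with `∑_{S ∈ G} (D/n)^{|S|} ≤ η`. Chain: `k'`-density `≤ 1/4` and Markov tail
`Pr_p[|W| > k'] ≤ 1/5` at `p = k'/(5n)` give `μ_p(U) ≤ 1/2` (`sum_biasedWeight_upset_le`);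
Park–Pham gives a cover of `q`-cost `< 1`, `q = p/(B log 2n)`; rescale to `D/n ≤ η q`. Applied
below to the clique-completion up-set `{A | f (plant A x) = 1}` of a monotone test. [folklore] -/
theorem exists_cheap_cover_of_kSet_le :
    ∀ {n : ℕ}, 1 ≤ n → ∀ (U : Set (Finset (Fin n))), (∀ S T : Finset (Fin n), S ⊆ T → S ∈ U → T ∈ U) →
      ∀ {k' D : ℕ}, 1 ≤ k' → k' ≤ n → ∀ {η : ℝ}, 0 < η → η ≤ 1 →
        5 * spreadConst * Real.log ((n : ℕ) / (1 / 2 : ℝ)) * D ≤ η * k' →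
          (PMF.uniformOfFinset (kSubsets n k') (kSubsets_nonempty n k')).toOuterMeasure U ≤ 4⁻¹ →
            ∃ G : Finset (Finset (Fin n)), (∀ A ∈ U, ∃ S ∈ G, S ⊆ A) ∧ ∑ S ∈ G, ((D : ℝ) / n) ^ #S ≤ η := by
  intro n hn U hU k' D hk'1 hk'n η hη0 hη1 hscale hμ
  have hnr : (0 : ℝ) < n := by exact_mod_cast hn
  have hk'r : (0 : ℝ) < k' := by exact_mod_cast hk'1
  -- the bias `p = k'/(5n)`
  set p : ℝ := (k' : ℝ) / (5 * n) with hp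
  have hp0 : 0 < p := by positivity
  have hp1 : p ≤ 1 / 2 := by
    rw [hp, div_le_iff₀ (by positivity)]
    have : (k' : ℝ) ≤ n := by exact_mod_cast hk'n
    linarith
  -- (1) the `k'`-density is `≤ 1/4`
  have hmin : min k' n = k' := min_eq_left hk'n
  have hkS : kSubsets n k' = powersetCard k' (univ : Finset (Fin n)) := by rw [kSubsets, hmin]
  rw [PMF.toOuterMeasure_uniformOfFinset_apply, hkS, card_powersetCard, card_univ, Fintype.card_fin] at hμ
  have hdens := natCast_div_le_quarter (Nat.choose_pos hk'n) hμ
  -- (2) the Markov tail is `≤ 1/5`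
  have htail : ∑ W ∈ univ.filter (fun W : Finset (Fin n) => k' < #W), biasedWeight p W ≤ 1 / 5 := by
    have h := mul_sum_biasedWeight_card_gt_le (α := Fin n) hp0.le (by linarith) k'
    rw [Fintype.card_fin] at h
    have hpn : p * n = (k' : ℝ) / 5 := by rw [hp]; field_simp
    rw [hpn] at h
    have : ∑ W ∈ univ.filter (fun W : Finset (Fin n) => k' < #W), biasedWeight p W ≤ ((k' : ℝ) / 5) / k' :=
      by rw [le_div_iff₀ hk'r, mul_comm]; exact h
    calc _ ≤ ((k' : ℝ) / 5) / k' := this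
      _ = 1 / 5 := by field_simp
  -- (3) biased measure `≤ 1/2`
  have h3 := sum_biasedWeight_upset_le U hU hk'n hp0.le (by linarith : p ≤ 1)
  have hμp : ∑ W ∈ univ.filter (fun W : Finset (Fin n) => W ∈ U), biasedWeight p W ≤ 1 / 2 := by
    linarith
  -- (4) Park–Pham: a cover of `q`-cost `< 1`
  obtain ⟨G, hGcov, hGcost⟩ := exists_cover_cost_lt_one_of_biased_le_half hn U hU hp0 hp1 hμp
  refine ⟨G, hGcov, ?_⟩
  -- (5) rescale: `D/n ≤ η q` from `5 B L D ≤ η k'`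
  have hL : 0 < Real.log ((n : ℕ) / (1 / 2 : ℝ)) := by
    apply Real.log_pos
    rw [lt_div_iff₀ (by norm_num : (0 : ℝ) < 1 / 2)]
    have : (1 : ℝ) ≤ n := by exact_mod_cast hn
    linarith
  set L : ℝ := Real.log ((n : ℕ) / (1 / 2 : ℝ)) with hLdef
  set q : ℝ := p / (spreadConst * L) with hq
  have hB := spreadConst_pos
  have hq0 : 0 ≤ q := by positivity
  refine sum_pow_card_le_of_scale hq0 (by positivity) hη0.le hη1 ?_ hGcost
  have key : (D : ℝ) / n ≤ (η * k') / (5 * n * (spreadConst * L)) := by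
    rw [div_le_div_iff₀ hnr (by positivity)]
    calc (D : ℝ) * (5 * n * (spreadConst * L)) = n * (5 * spreadConst * L * D) := by ring
      _ ≤ n * (η * k') := mul_le_mul_of_nonneg_left hscale hnr.le
      _ = η * k' * n := by ring
  calc (D : ℝ) / n ≤ (η * k') / (5 * n * (spreadConst * L)) := key
    _ = η * q := by
        rw [hq, hp]
        field_simp

end Summit.PneNP.PneNP.Theorems.MonotoneBlind.VertexCover
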